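import Literature.NumberTheory.Automorphic.ShimuraCurveCartanLevelHeckeDegree
import Literature.NumberTheory.Automorphic.ShimuraCurveCartanLevelCommonReduction
import Literature.NumberTheory.Automorphic.ShimuraParametrizationSplitCaseProofs
import HarnessLib

/-!
# `T_ℓ T_ℓ' = T_ℓ' T_ℓ` on a Cartan-level Shimura curve for good primes `ℓ ≠ ℓ'`:
# Eichler's unique factorisation in the Cartan order `O` of `X : CartanLevelCurveData D M C`

Topic `NumberTheory/Automorphic`; theorems only (no definition, no named fact, no instance, no
`sorry`). Let `X : CartanLevelCurveData D M C` (`ShimuraCurveCartanLevel.lean`): an indefinite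
quaternion algebra `B/ℚ` of discriminant `D` with real splitting `ι`, Eichler hull `O₀` of level `M`,
Cartan order `O ⊆ O₀` of level `(M; C)` (non-split Cartan at the primes `q ∈ C`), `Γ = ι(O¹)`,
`X.heckeSet n = ι(O(n))`, `X.heckeFun n h = Σ_{Γ∖ι(O(n))} h ∣[2] g` (Kohen–Pacetti's Hecke operators of
`X_ns` away from the level). For two distinct primes `ℓ, ℓ'` not dividing `D M ∏_C q`:

* §1 `exists_normOne_of_mul_eq_mul` — UNIQUENESS of a factorisation `c = a b` (`nrd a = n₁`,
  `nrd b = n₂`, `gcd(n₁, n₂) = 1`) up to a unit of `O` of reduced norm `1` (Bezout; any order —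
  VERBATIM the argument of `ShimuraCurveData.exists_unit_of_mul_eq_mul`, in `reducedNorm` currency).
* §2 `exists_mul_eq_of_reducedNorm_eq_mul` — EXISTENCE: every `c ∈ O` with `nrd c = ℓ' ℓ` is
  `c = a b` with `a, b ∈ O`, `nrd a = ℓ'`, `nrd b = ℓ`. In the hull `O₀` this is Eichler's unique
  factorisation (`D > 1`: `ShimuraCurveData.exists_mul_eq_of_reducedNorm_eq_mul`, §0' — the
  invertible right ideal `c O₀ + ℓ' O₀` is principal by Eichler's theorem `exists_eq_units_smul_of_pos`
  (`ShimuraCurveIdealsPrincipal.lean`), VERBATIM the argument of `exists_mul_eq_of_nrdZ_eq_mul` of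
  `ShimuraCurveHeckeMultiplicativityProofs.lean` in `reducedNorm` currency — applied to the Eichler datum
  `X.toShimuraCurveData`; `D = 1`: the split dictionary `ShimuraCurveData.exists_conj_of_discr_one`,
  `ι(O₀) = h {A : M ∣ A₁₀} h⁻¹`, and column reduction of a `2 × 2` integer matrix of determinant
  `ℓ' ℓ` modulo `ℓ`, `exists_intMatrix_mul_eq_of_det_eq_mul`); the factor `b₀` of prime norm `ℓ` is
  then moved into `O` by a norm-one hull unit (`exists_normOne_mul_mem`, Eichler–Kneser strong
  approximation, `ShimuraCurveCartanLevelHeckeCosets.lean`), and the cofactor lies in `O` by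
  saturation across the coprime conductor `∏_C q` (`mem_of_smul_mem_of_mul_mem_of_reducedNorm`).
* §3 the coset spaces: `ι(O(n₁)) ι(O(n₂)) ⊆ ι(O(n₁ n₂))` and the map `(Γα, Γβ) ↦ Γ α β_out`,
  `Γ∖ι(O(ℓ')) × Γ∖ι(O(ℓ)) → Γ∖ι(O(ℓ' ℓ))`, is a bijection (`exists_mk_out_mul_out_eq`,
  `eq_of_mk_out_mul_out_eq`) — VERBATIM the port of `ShimuraCurveHeckeMultiplicativityProofs` §2;
  hence `Γ∖ι(O(ℓ' ℓ))` is finite (`finite_quotient_heckeSetoid_mul`; the prime case is the tree's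
  `cartanLevel_card_heckeCosets_eq_holds`).
* §4 `heckeFun_heckeFun_of_primes` (`T_ℓ (T_ℓ' h) = T_{ℓ'ℓ} h` for `Γ`-invariant `h` of weight `2`)
  and `heckeFun_comm_of_primes` (`T_ℓ (T_ℓ' h) = T_ℓ' (T_ℓ h)`).

This is the print content of Shimura's commutativity of the Hecke ring of a quaternion unit group
away from the level (IATAF Prop. 3.8 with §3.3) in Eichler's elementwise form (LNM 320, II §6
Thm. 2 (18): `T(ℓ)T(ℓ') = T(ℓℓ')`), for the non-Eichler Cartan orders of Kohen–Pacetti; used by the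
BSD cell `bsd-stepL` (seat `defn-ty1` g44) to discharge the named fact
`unitsHeckeFun_comm_cartanCover` (`QuaternionOrderHeckeJacquetLanglands.lean`) for the cover order of
a Cartan datum, which is again a Cartan datum (`ShimuraCurveCartanLevelErase.lean`). Nothing
arithmetic is asserted; BSD is proved for no curve.

## References

* M. Eichler, *The basis problem for modular forms and the traces of the Hecke operators*, LNM 320
  (1973), Ch. II §6 Thm. 2 (18), (23). [cite: Eichler1973, Ch. II §6 Thm. 2]
* G. Shimura, *Introduction to the arithmetic theory of automorphic functions* (1971), Prop. 3.8,
  §3.3, Prop. 3.36. [cite: ShimuraIATAF1971, Prop. 3.8 and §3.3]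
* M.-F. Vignéras, *Arithmétique des algèbres de quaternions*, LNM 800 (1980), Ch. III §4 Thm. 4.3,
  §5 Cor. 5.7. [cite: VignerasLNM800, Ch. III §5 Cor. 5.7]
* D. Kohen, A. Pacetti, *Heegner points on Cartan non-split curves*, Canad. J. Math. 68 (2016),
  §1.3, §2. [cite: KohenPacetti2016, §1.3]
* F. Diamond, J. Shurman, *A first course in modular forms* (2005), Prop. 5.2.1 (the split case).
  [cite: DiamondShurman2005, Prop. 5.2.1]
-/

noncomputable section

open UpperHalfPlane
open scoped Pointwise MatrixGroups ModularForm

namespace Literature.NumberTheory.Automorphic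

/-! ### 0. Column reduction of a `2 × 2` integer matrix of determinant `n ℓ` modulo a prime `ℓ`
(the split case `D = 1`) -/

section IntMatrix

/-- **Factorisation of integer matrices of determinant `n ℓ` (`ℓ` prime) inside
`Δ₀(M) = {A : M ∣ A₁₀}`**, for `ℓ ∤ M`: `A = A' B` with `det B = ℓ`, `det A' = n`, `M ∣ B₁₀`,
`M ∣ A'₁₀` — take `B = diag(ℓ, 1)` if `ℓ` divides the first column of `A`, and otherwise
`B = (1 j; 0 ℓ)` with `j` the ratio of the two columns modulo `ℓ` (they are proportional since
`det A ≡ 0 (mod ℓ)`); the classical coset representatives of `Γ₀(M) ∖ Δ₀ᴹ(ℓ)`.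
[cite: DiamondShurman2005, Prop. 5.2.1] [cite: ShimuraIATAF1971, Prop. 3.36 and §3.3] -/
theorem exists_intMatrix_mul_eq_of_det_eq_mul {M ℓ : ℕ} (hℓ : ℓ.Prime) (hℓM : ¬ ℓ ∣ M) {n : ℤ}
    {A : Matrix (Fin 2) (Fin 2) ℤ} (hdet : A.det = n * ℓ) (hA : (M : ℤ) ∣ A 1 0) :
    ∃ A' B : Matrix (Fin 2) (Fin 2) ℤ, A' * B = A ∧ A'.det = n ∧ B.det = ℓ ∧
      (M : ℤ) ∣ A' 1 0 ∧ (M : ℤ) ∣ B 1 0 := by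
  have hℓ0 : (ℓ : ℤ) ≠ 0 := by exact_mod_cast hℓ.ne_zero
  haveI : Fact ℓ.Prime := ⟨hℓ⟩
  rw [Matrix.det_fin_two] at hdet
  by_cases h1 : (ℓ : ℤ) ∣ A 0 0 ∧ (ℓ : ℤ) ∣ A 1 0
  · -- `B = diag(ℓ, 1)`
    obtain ⟨⟨a, ha⟩, ⟨c, hc⟩⟩ := h1
    refine ⟨!![a, A 0 1; c, A 1 1], !![(ℓ : ℤ), 0; 0, 1], ?_, ?_, ?_, ?_, ?_⟩
    · ext i j
      fin_cases i <;> fin_cases j <;> simp [Matrix.mul_apply, Fin.sum_univ_two, ha, hc, mul_comm]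
    · rw [Matrix.det_fin_two_of]
      apply mul_left_cancel₀ hℓ0
      rw [ha, hc] at hdet
      linear_combination hdet
    · rw [Matrix.det_fin_two_of]; ring
    · -- `M ∣ c` since `M ∣ ℓ c` and `gcd(ℓ, M) = 1`
      change (M : ℤ) ∣ c
      rw [hc] at hA
      have hcop : IsCoprime (M : ℤ) (ℓ : ℤ) :=
        Nat.isCoprime_iff_coprime.mpr (Nat.Coprime.symm ((Nat.Prime.coprime_iff_not_dvd hℓ).mpr hℓM))
      exact hcop.dvd_of_dvd_mul_left hA
    · change (M : ℤ) ∣ 0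
      exact dvd_zero _
  · -- the columns are proportional modulo `ℓ`: `A_{i1} ≡ j A_{i0}`
    have hprop : ∃ j : ℤ, (ℓ : ℤ) ∣ A 0 1 - j * A 0 0 ∧ (ℓ : ℤ) ∣ A 1 1 - j * A 1 0 := by
      have hdet' : ((A 0 0 : ZMod ℓ)) * (A 1 1 : ZMod ℓ) = (A 0 1 : ZMod ℓ) * (A 1 0 : ZMod ℓ) := by
        have h : ((A 0 0 * A 1 1 - A 0 1 * A 1 0 : ℤ) : ZMod ℓ) = ((n * ℓ : ℤ) : ZMod ℓ) := by
          rw [hdet]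
        push_cast at h
        rw [ZMod.natCast_self, mul_zero, sub_eq_zero] at h
        exact h
      rw [not_and_or] at h1
      rcases h1 with h00 | h10
      · -- `A₀₀` invertible mod `ℓ`
        have hu : (A 0 0 : ZMod ℓ) ≠ 0 := by
          rwa [Ne, ZMod.intCast_zmod_eq_zero_iff_dvd]
        set j : ZMod ℓ := (A 0 1 : ZMod ℓ) * (A 0 0 : ZMod ℓ)⁻¹ with hj
        refine ⟨j.val, ?_, ?_⟩
        · rw [← ZMod.intCast_zmod_eq_zero_iff_dvd]
          push_cast
          rw [ZMod.natCast_zmod_val, hj, mul_assoc, inv_mul_cancel₀ hu, mul_one, sub_self]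
        · rw [← ZMod.intCast_zmod_eq_zero_iff_dvd]
          push_cast
          rw [ZMod.natCast_zmod_val, hj]
          have : (A 0 1 : ZMod ℓ) * (A 0 0 : ZMod ℓ)⁻¹ * (A 1 0 : ZMod ℓ) = (A 1 1 : ZMod ℓ) := by
            calc (A 0 1 : ZMod ℓ) * (A 0 0 : ZMod ℓ)⁻¹ * (A 1 0 : ZMod ℓ)
                = ((A 0 1 : ZMod ℓ) * (A 1 0 : ZMod ℓ)) * (A 0 0 : ZMod ℓ)⁻¹ := by ring
              _ = ((A 0 0 : ZMod ℓ) * (A 1 1 : ZMod ℓ)) * (A 0 0 : ZMod ℓ)⁻¹ := by rw [hdet']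
              _ = (A 1 1 : ZMod ℓ) := by
                rw [mul_comm (A 0 0 : ZMod ℓ), mul_assoc, mul_inv_cancel₀ hu, mul_one]
          rw [this, sub_self]
      · -- `A₁₀` invertible mod `ℓ`
        have hu : (A 1 0 : ZMod ℓ) ≠ 0 := by
          rwa [Ne, ZMod.intCast_zmod_eq_zero_iff_dvd]
        set j : ZMod ℓ := (A 1 1 : ZMod ℓ) * (A 1 0 : ZMod ℓ)⁻¹ with hj
        refine ⟨j.val, ?_, ?_⟩
        · rw [← ZMod.intCast_zmod_eq_zero_iff_dvd]
          push_cast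
          rw [ZMod.natCast_zmod_val, hj]
          have : (A 1 1 : ZMod ℓ) * (A 1 0 : ZMod ℓ)⁻¹ * (A 0 0 : ZMod ℓ) = (A 0 1 : ZMod ℓ) := by
            calc (A 1 1 : ZMod ℓ) * (A 1 0 : ZMod ℓ)⁻¹ * (A 0 0 : ZMod ℓ)
                = ((A 0 0 : ZMod ℓ) * (A 1 1 : ZMod ℓ)) * (A 1 0 : ZMod ℓ)⁻¹ := by ring
              _ = ((A 0 1 : ZMod ℓ) * (A 1 0 : ZMod ℓ)) * (A 1 0 : ZMod ℓ)⁻¹ := by rw [hdet']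
              _ = (A 0 1 : ZMod ℓ) := by rw [mul_assoc, mul_inv_cancel₀ hu, mul_one]
          rw [this, sub_self]
        · rw [← ZMod.intCast_zmod_eq_zero_iff_dvd]
          push_cast
          rw [ZMod.natCast_zmod_val, hj, mul_assoc, inv_mul_cancel₀ hu, mul_one, sub_self]
    obtain ⟨j, ⟨b, hb⟩, ⟨d, hd⟩⟩ := hprop
    -- `B = (1 j; 0 ℓ)`, `A' = (A₀₀ b; A₁₀ d)` with `A₀₁ = j A₀₀ + ℓ b`, `A₁₁ = j A₁₀ + ℓ d`
    refine ⟨!![A 0 0, b; A 1 0, d], !![1, j; 0, (ℓ : ℤ)], ?_, ?_, ?_, ?_, ?_⟩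
    · ext i j'
      fin_cases i <;> fin_cases j' <;>
        simp [Matrix.mul_apply, Fin.sum_univ_two] <;> linarith
    · rw [Matrix.det_fin_two_of]
      apply mul_left_cancel₀ hℓ0
      have e1 : A 0 1 = j * A 0 0 + ℓ * b := by linarith
      have e2 : A 1 1 = j * A 1 0 + ℓ * d := by linarith
      rw [e1, e2] at hdet
      linear_combination hdet
    · rw [Matrix.det_fin_two_of]; ring
    · exact hA
    · change (M : ℤ) ∣ 0
      exact dvd_zero _

end IntMatrix

/-! ### 0'. Eichler's factorisation in the Eichler order of `X₀^D(M)` (`D > 1`), elementwise -/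

namespace ShimuraCurveData

variable {D M : ℕ} (X : ShimuraCurveData D M)

/-- `nrdZ` of a natural number `n ∈ O` is `n²`. [cite: VignerasLNM800, Ch. I §1 Lemme 1.1] -/
private theorem nrdZ_natCast' (n : ℕ) : nrdZ ((n : X.B)) = (n : ℤ) ^ 2 := by
  have hZ := X.isZOrder
  have hn : ((n : X.B)) ∈ X.O := by
    simpa using X.O.smul_mem (n : ℤ) hZ.one_mem
  have h : (nrdZ (n : X.B) : ℚ) = ((n : ℤ) ^ 2 : ℤ) := by
    rw [hZ.cast_nrdZ hn, show ((n : X.B)) = algebraMap ℚ X.B (n : ℚ) by simp,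
      reducedNorm_algebraMap]
    push_cast
    ring
  exact_mod_cast h

/-- **Existence of the factorisation in the Eichler order (`D > 1`), reduced-norm currency.** Every
`c ∈ O` with `nrd c = n₁ n₂`, `gcd(n₁, n₂) = 1`, `n₁, n₂ ≥ 1`, factors as `c = a b` with `a, b ∈ O`,
`nrd a = n₁`, `nrd b = n₂`: the right ideal `K = c O + n₁ O` is invertible
(`IsInvertibleRightIdeal.sup_smul`, as `n₁ n₂ O = c c̄ O ⊆ c O`), hence principal, `K = a O` with
`nrd a > 0`, by Eichler's theorem for the Eichler order of `X₀^D(M)` (`exists_eq_units_smul_of_pos`);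
then `c = a b`, and `nrd a = n₁` because `n₁ ∣ nrd a` (polarisation), `nrd a ∣ n₁²` and
`nrd a ∣ n₁ n₂`. (The same statement in `nrdZ` currency is `exists_mul_eq_of_nrdZ_eq_mul` of
`ShimuraCurveHeckeMultiplicativityProofs`; restated over `reducedNorm` for the Cartan-level files,
which work with `reducedNorm`.) [cite: Eichler1973, Ch. II §6 Thm. 2] [cite: VignerasLNM800, Ch. III §5 Cor. 5.7] -/
theorem exists_mul_eq_of_reducedNorm_eq_mul (hD : 1 < D) (hM : 0 < M) {c : X.B} (hc : c ∈ X.O)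
    {n₁ n₂ : ℕ} (hn₁ : 0 < n₁) (hn₂ : 0 < n₂) (hcop : n₁.Coprime n₂)
    (hnrd : reducedNorm ℚ X.B c = n₁ * n₂) :
    ∃ a ∈ X.O, ∃ b ∈ X.O, a * b = c ∧ reducedNorm ℚ X.B a = n₁ ∧ reducedNorm ℚ X.B b = n₂ := by
  classical
  haveI := X.nontrivial_B
  haveI := X.charZero_B
  have hZ := X.isZOrder
  have hnrdZ : nrdZ c = n₁ * n₂ := by
    have h : (nrdZ c : ℚ) = ((n₁ * n₂ : ℕ) : ℚ) := by rw [hZ.cast_nrdZ hc, hnrd]; push_cast; ring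
    exact_mod_cast h
  have hc0 : c ≠ 0 := by
    rintro rfl
    rw [reducedNorm_apply_zero] at hnrd
    have : (n₁ : ℚ) * n₂ = 0 := hnrd.symm
    rcases mul_eq_zero.mp this with h | h
    · exact hn₁.ne' (by exact_mod_cast h)
    · exact hn₂.ne' (by exact_mod_cast h)
  set u : (X.B)ˣ := (X.isUnit_of_ne_zero hD c hc0).unit with hudef
  have hu : (u : X.B) = c := (X.isUnit_of_ne_zero hD c hc0).unit_spec
  -- the right ideal `K = c O + n₁ O`
  have hMinv : IsInvertibleRightIdeal X.O (u • X.O) := hZ.isInvertibleRightIdeal_self.units_smul u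
  have hMI : u • X.O ≤ X.O := by
    refine (Brandt.units_smul_le_iff_mem_leftOrder X.O u).mpr ?_
    rw [hZ.toIsOrder.leftOrder_eq, hu]
    exact hc
  obtain ⟨s, t, hst⟩ := Nat.isCoprime_iff_coprime.mpr hcop
  have hcd : ((n₁ : ℤ) * (n₂ : ℤ)) • X.O ≤ u • X.O := by
    intro z hz
    obtain ⟨x, hx, rfl⟩ := (Submodule.mem_smul_pointwise_iff_exists z _ X.O).mp hz
    refine (Submodule.mem_smul_pointwise_iff_exists _ _ _).mpr
      ⟨standardInvolution ℚ X.B c * x, hZ.mul_mem _ (hZ.standardInvolution_mem hc) _ hx, ?_⟩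
    rw [Units.smul_def, hu, smul_eq_mul, ← mul_assoc, hZ.mul_standardInvolution_eq hc, hnrdZ,
      smul_mul_assoc, one_mul]
  have hK : IsInvertibleRightIdeal X.O (u • X.O ⊔ ((n₁ : ℤ)) • X.O) :=
    hMinv.sup_smul hZ.isInvertibleRightIdeal_self hMI hst hcd
  have hKO : u • X.O ⊔ ((n₁ : ℤ)) • X.O ≤ X.O := by
    refine sup_le hMI fun z hz => ?_
    obtain ⟨x, hx, rfl⟩ := (Submodule.mem_smul_pointwise_iff_exists z _ X.O).mp hz
    exact X.O.smul_mem _ hx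
  obtain ⟨β, hβO, hβpos, hKβ⟩ := X.exists_eq_units_smul_of_pos hD hM hK hKO
  -- memberships
  have hcK : c ∈ (β • X.O : Submodule ℤ X.B) := by
    rw [← hKβ]
    refine Submodule.mem_sup_left ((Submodule.mem_smul_pointwise_iff_exists _ _ _).mpr
      ⟨1, hZ.one_mem, ?_⟩)
    rw [Units.smul_def, hu, smul_eq_mul, mul_one]
  have hn₁K : ((n₁ : ℤ) • (1 : X.B)) ∈ (β • X.O : Submodule ℤ X.B) := by
    rw [← hKβ]
    exact Submodule.mem_sup_right (Submodule.smul_mem_pointwise_smul _ _ _ hZ.one_mem)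
  have hβK : (β : X.B) ∈ u • X.O ⊔ ((n₁ : ℤ)) • X.O := by
    rw [hKβ]
    exact (Submodule.mem_smul_pointwise_iff_exists _ _ _).mpr
      ⟨1, hZ.one_mem, by rw [Units.smul_def, smul_eq_mul, mul_one]⟩
  obtain ⟨b, hb, hbc⟩ := (Submodule.mem_smul_pointwise_iff_exists _ _ _).mp hcK
  obtain ⟨e, he, hen⟩ := (Submodule.mem_smul_pointwise_iff_exists _ _ _).mp hn₁K
  rw [Units.smul_def, smul_eq_mul] at hbc hen
  obtain ⟨z₁, hz₁, z₂, hz₂, hz⟩ := Submodule.mem_sup.mp hβK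
  obtain ⟨x, hx, rfl⟩ := (Submodule.mem_smul_pointwise_iff_exists z₁ _ X.O).mp hz₁
  obtain ⟨y, hy, rfl⟩ := (Submodule.mem_smul_pointwise_iff_exists z₂ _ X.O).mp hz₂
  rw [Units.smul_def, hu, smul_eq_mul] at hz
  -- norms
  have h1 : nrdZ (β : X.B) * nrdZ b = n₁ * n₂ := by rw [← hZ.nrdZ_mul hβO hb, hbc, hnrdZ]
  have h2 : nrdZ (β : X.B) * nrdZ e = n₁ ^ 2 := by
    rw [← hZ.nrdZ_mul hβO he, hen]
    have : ((n₁ : ℤ) • (1 : X.B)) = ((n₁ : ℕ) : X.B) := by simp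
    rw [this, X.nrdZ_natCast']
  have h3 : (n₁ : ℤ) ∣ nrdZ (β : X.B) := by
    -- polarisation: `nrd(c x + n₁ y) = n₁ n₂ nrd x + n₁² nrd y + n₁ trd(c x ȳ)`
    have hcx : c * x ∈ X.O := hZ.mul_mem _ hc _ hx
    have hq : (nrdZ (β : X.B) : ℚ) =
        n₁ * (n₂ * nrdZ x + n₁ * nrdZ y + trdZ (c * x * standardInvolution ℚ X.B y)) := by
      rw [hZ.cast_nrdZ hβO, ← hz, reducedNorm_add, ← Int.cast_smul_eq_zsmul ℚ, standardInvolution_smul,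
        mul_smul_comm, map_smul, reducedNorm_smul, reducedNorm_mul_holds ℚ X.B c x,
        hnrd, ← hZ.cast_nrdZ hx, ← hZ.cast_nrdZ hy,
        ← hZ.cast_trdZ (hZ.mul_mem _ hcx _ (hZ.standardInvolution_mem hy)), smul_eq_mul]
      push_cast
      ring
    have hq' : nrdZ (β : X.B) =
        n₁ * (n₂ * nrdZ x + n₁ * nrdZ y + trdZ (c * x * standardInvolution ℚ X.B y)) := by
      exact_mod_cast hq
    exact ⟨_, hq'⟩
  have hβpos' : 0 < nrdZ (β : X.B) := by
    have : (0 : ℚ) < nrdZ (β : X.B) := by rw [hZ.cast_nrdZ hβO]; exact hβpos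
    exact_mod_cast this
  -- `nrd β = n₁`
  obtain ⟨k, hk⟩ := h3
  have hn₁' : (n₁ : ℤ) ≠ 0 := by exact_mod_cast hn₁.ne'
  have hk1 : k ∣ (n₁ : ℤ) := by
    refine ⟨nrdZ e, mul_left_cancel₀ hn₁' ?_⟩
    rw [← mul_assoc, ← hk, h2, sq]
  have hk2 : k ∣ (n₂ : ℤ) := by
    refine ⟨nrdZ b, mul_left_cancel₀ hn₁' ?_⟩
    rw [← mul_assoc, ← hk, h1]
  have hkunit : IsUnit k := by
    obtain ⟨k₁, hk₁⟩ := hk1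
    obtain ⟨k₂, hk₂⟩ := hk2
    refine isUnit_of_dvd_one ⟨s * k₁ + t * k₂, ?_⟩
    rw [← hst, hk₁, hk₂]
    ring
  have hkone : k = 1 := by
    rcases Int.isUnit_iff.mp hkunit with rfl | rfl
    · rfl
    · exfalso
      rw [mul_neg, mul_one] at hk
      have : (0 : ℤ) < n₁ := by exact_mod_cast hn₁
      omega
  rw [hkone, mul_one] at hk
  rw [hk] at h1
  have hnb : nrdZ b = n₂ := mul_left_cancel₀ hn₁' h1
  refine ⟨β, hβO, b, hb, hbc, ?_, ?_⟩
  · rw [← hZ.cast_nrdZ hβO, hk, Int.cast_natCast]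
  · rw [← hZ.cast_nrdZ hb, hnb, Int.cast_natCast]

end ShimuraCurveData

namespace CartanLevelCurveData

variable {D M : ℕ} {C : Finset ℕ} (X : CartanLevelCurveData D M C)

/-! ### 1. Bookkeeping: norms of Hecke elements, units of norm one, uniqueness of factorisations -/

/-- An element of `ι(O(n))` is `ι(x)` with `x ∈ O` of reduced norm `n` (`det ∘ ι = nrd`).
[cite: VignerasLNM800, Ch. I §1 Lemme 1.1] -/
private theorem exists_mem_O_ι_eq_of_mem_heckeSet {n : ℕ} {g : GL (Fin 2) ℝ} (hg : g ∈ X.heckeSet n) :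
    ∃ x ∈ X.O, X.ι x = (g : Matrix (Fin 2) (Fin 2) ℝ) ∧ reducedNorm ℚ X.B x = n := by
  obtain ⟨⟨x, hx, hxg⟩, hdet⟩ := hg
  exact ⟨x, hx, hxg, reducedNorm_eq_natCast_of_det_eq X.ι hxg hdet⟩

/-- For `x ∈ O` with `nrd x = n ≥ 1`, the matrix `ι(x)` as an element of `ι(O(n))`.
[cite: VignerasLNM800, Ch. I §1 Lemme 1.1] -/
theorem exists_heckeSet_coe_eq_ι {x : X.B} (hx : x ∈ X.O) {n : ℕ} (hn : 0 < n)
    (hxn : reducedNorm ℚ X.B x = n) :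
    ∃ g : X.heckeSet n, ((g : GL (Fin 2) ℝ) : Matrix (Fin 2) (Fin 2) ℝ) = X.ι x := by
  have hdet : (X.ι x).det = n := by
    rw [AlgHom.det_eq_reducedNorm X.ι, hxn, map_natCast]
  exact ⟨⟨Matrix.GeneralLinearGroup.mkOfDetNeZero (X.ι x)
    (by rw [hdet]; exact_mod_cast hn.ne'), ⟨x, hx, rfl⟩, hdet⟩, rfl⟩

/-- An element of `Γ = ι(O¹)` is `ι(u)` with `u ∈ O`, `nrd u = 1`. [cite: VignerasLNM800, Ch. IV §1] -/
theorem exists_mem_O_ι_eq_of_mem_Gamma {γ : GL (Fin 2) ℝ} (hγ : γ ∈ X.Gamma) :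
    ∃ u ∈ X.O, X.ι u = (γ : Matrix (Fin 2) (Fin 2) ℝ) ∧ reducedNorm ℚ X.B u = 1 := by
  obtain ⟨⟨u, hu, huγ⟩, -, hdet⟩ := hγ
  refine ⟨u, hu, huγ, ?_⟩
  have h : (γ : Matrix (Fin 2) (Fin 2) ℝ).det = ((1 : ℕ) : ℝ) := by
    rw [← Matrix.GeneralLinearGroup.val_det_apply, hdet, Units.val_one, Nat.cast_one]
  have := reducedNorm_eq_natCast_of_det_eq X.ι huγ h
  rw [this, Nat.cast_one]

/-- A unit `u ∈ O` of reduced norm `1` gives `ι(u) ∈ Γ` (inverse `ι(ū)`). [cite: VignerasLNM800, Ch. IV §1] -/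
theorem exists_mem_Gamma_coe_eq_ι {u : X.B} (hu : u ∈ X.O) (hnu : reducedNorm ℚ X.B u = 1) :
    ∃ γ ∈ X.Gamma, (γ : Matrix (Fin 2) (Fin 2) ℝ) = X.ι u := by
  set ub : X.B := standardInvolution ℚ X.B u with hub
  have hubO : ub ∈ X.O := X.isOrder.standardInvolution_mem hu
  have hubu : ub * u = 1 := by
    rw [hub, IsQuaternionAlgebra.standardInvolution_mul (K := ℚ), hnu, map_one]
  have hdet1 : (X.ι u).det = 1 := by
    rw [AlgHom.det_eq_reducedNorm X.ι, hnu, map_one]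
  set γ : GL (Fin 2) ℝ := Matrix.GeneralLinearGroup.mkOfDetNeZero (X.ι u)
    (by rw [hdet1]; exact one_ne_zero) with hγ
  have hγval : (γ : Matrix (Fin 2) (Fin 2) ℝ) = X.ι u := rfl
  have hγinv : ((γ⁻¹ : GL (Fin 2) ℝ) : Matrix (Fin 2) (Fin 2) ℝ) = X.ι ub := by
    rw [Matrix.coe_units_inv, hγval]
    exact Matrix.inv_eq_left_inv (by rw [← map_mul, hubu, map_one])
  refine ⟨γ, ⟨⟨u, hu, hγval.symm⟩, ⟨ub, hubO, hγinv.symm⟩, ?_⟩, hγval⟩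
  ext
  rw [Matrix.GeneralLinearGroup.val_det_apply, hγval, hdet1, Units.val_one]

/-- `ι(O(n)) · Γ ⊆ ι(O(n))`. [cite: ShimuraIATAF1971, §3.3] -/
private theorem mul_mem_heckeSet {n : ℕ} {a γ : GL (Fin 2) ℝ} (ha : a ∈ X.heckeSet n) (hγ : γ ∈ X.Gamma) :
    a * γ ∈ X.heckeSet n := by
  obtain ⟨⟨x, hx, hxa⟩, hdet⟩ := ha
  obtain ⟨⟨u, hu, huγ⟩, -, hdetγ⟩ := hγ
  refine ⟨⟨x * u, X.isOrder.mul_mem _ hx _ hu, by rw [map_mul, hxa, huγ, Units.val_mul]⟩, ?_⟩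
  rw [Units.val_mul, Matrix.det_mul, hdet, ← Matrix.GeneralLinearGroup.val_det_apply, hdetγ,
    Units.val_one, mul_one]

/-- `ι(O(n₁)) ι(O(n₂)) ⊆ ι(O(n₁ n₂))`. [cite: ShimuraIATAF1971, §3.3] -/
private theorem mul_mem_heckeSet_mul {n₁ n₂ : ℕ} {a b : GL (Fin 2) ℝ} (ha : a ∈ X.heckeSet n₁)
    (hb : b ∈ X.heckeSet n₂) : a * b ∈ X.heckeSet (n₁ * n₂) := by
  obtain ⟨⟨x, hx, hxa⟩, hdeta⟩ := ha
  obtain ⟨⟨y, hy, hyb⟩, hdetb⟩ := hb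
  refine ⟨⟨x * y, X.isOrder.mul_mem _ hx _ hy, by rw [map_mul, hxa, hyb, Units.val_mul]⟩, ?_⟩
  rw [Units.val_mul, Matrix.det_mul, hdeta, hdetb, Nat.cast_mul]

/-- **Uniqueness of a factorisation up to `O¹`** (any order; Bezout). If `a b = a' b'` in `O` with
`nrd a' = n₁`, `nrd b = nrd b' = n₂`, `gcd(n₁, n₂) = 1` and `n₂ ≠ 0`, then `b' = u b` and `a = a' u`
for a unit `u ∈ O` of reduced norm `1` (`u = s ā' a + t b' b̄`, `s n₁ + t n₂ = 1`). The uniqueness half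
of Eichler's unique factorisation of ideals of coprime norms, elementwise.
[cite: Eichler1973, Ch. II §6 Thm. 2] -/
theorem exists_normOne_of_mul_eq_mul {a a' b b' : X.B} (ha : a ∈ X.O) (ha' : a' ∈ X.O)
    (hb : b ∈ X.O) (hb' : b' ∈ X.O) {n₁ n₂ : ℕ} (hcop : n₁.Coprime n₂) (hn₂ : n₂ ≠ 0)
    (hna' : reducedNorm ℚ X.B a' = n₁) (hnb : reducedNorm ℚ X.B b = n₂)
    (hnb' : reducedNorm ℚ X.B b' = n₂) (heq : a * b = a' * b') :
    ∃ u ∈ X.O, reducedNorm ℚ X.B u = 1 ∧ u * b = b' ∧ a' * u = a := by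
  have hO := X.isOrder
  obtain ⟨s, t, hst⟩ := Nat.isCoprime_iff_coprime.mpr hcop
  set u : X.B := s • (standardInvolution ℚ X.B a' * a) + t • (b' * standardInvolution ℚ X.B b) with hu
  have huO : u ∈ X.O :=
    X.O.add_mem (X.O.smul_mem s (hO.mul_mem _ (hO.standardInvolution_mem ha') _ ha))
      (X.O.smul_mem t (hO.mul_mem _ hb' _ (hO.standardInvolution_mem hb)))
  have hub : u * b = b' := by
    have h1 : standardInvolution ℚ X.B a' * a * b = (n₁ : ℤ) • b' := by
      rw [mul_assoc, heq, ← mul_assoc, IsQuaternionAlgebra.standardInvolution_mul (K := ℚ), hna',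
        map_natCast, ← Int.cast_smul_eq_zsmul ℚ, Int.cast_natCast, Nat.cast_smul_eq_nsmul,
        nsmul_eq_mul]
    have h2 : b' * standardInvolution ℚ X.B b * b = (n₂ : ℤ) • b' := by
      rw [mul_assoc, IsQuaternionAlgebra.standardInvolution_mul (K := ℚ), hnb, map_natCast,
        ← Int.cast_smul_eq_zsmul ℚ, Int.cast_natCast, Nat.cast_smul_eq_nsmul, nsmul_eq_mul,
        Nat.cast_comm]
    rw [hu, add_mul, smul_mul_assoc, smul_mul_assoc, h1, h2, smul_smul, smul_smul, ← add_smul,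
      hst, one_smul]
  have hnu : reducedNorm ℚ X.B u = 1 := by
    have h := reducedNorm_mul_holds ℚ X.B u b
    rw [hub, hnb', hnb] at h
    have hn₂' : (n₂ : ℚ) ≠ 0 := by exact_mod_cast hn₂
    have : (n₂ : ℚ) * 1 = (n₂ : ℚ) * reducedNorm ℚ X.B u := by rw [mul_one, mul_comm]; exact h
    exact (mul_left_cancel₀ hn₂' this).symm
  refine ⟨u, huO, hnu, hub, ?_⟩
  -- `a' u b = a' b' = a b`, and `b` is a unit
  have hbunit : IsUnit b := by
    refine IsQuaternionAlgebra.isUnit_of_reducedNorm_ne_zero (K := ℚ) ?_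
    rw [hnb]
    exact_mod_cast hn₂
  obtain ⟨w, hw⟩ := hbunit
  have h : (a' * u) * b = a * b := by rw [mul_assoc, hub, heq]
  rw [← hw] at h
  exact (Units.mul_left_inj w).mp h

/-! ### 2. Existence of the factorisation in the Cartan order for two good primes -/

/-- **Factorisation in the hull.** Every `c ∈ O₀` with `nrd c = ℓ' ℓ` (`ℓ ≠ ℓ'` primes, `ℓ ∤ M`)
is `c = a₀ b₀` with `a₀, b₀ ∈ O₀`, `nrd a₀ = ℓ'`, `nrd b₀ = ℓ`: for `D > 1` Eichler's factorisation in
the Eichler order of `X₀^D(M)` (`ShimuraCurveData.exists_mul_eq_of_reducedNorm_eq_mul`), for `D = 1`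
the split dictionary `ι(O₀) = h Δ₀(M) h⁻¹` and `exists_intMatrix_mul_eq_of_det_eq_mul`.
[cite: Eichler1973, Ch. II §6 Thm. 2] [cite: DiamondShurman2005, Prop. 5.2.1] -/
theorem exists_mul_eq_of_reducedNorm_eq_mul_hull (hM : 0 < M) {ℓ ℓ' : ℕ} (hℓ : ℓ.Prime)
    (hℓ' : ℓ'.Prime) (hne : ℓ ≠ ℓ') (hℓM : ¬ ℓ ∣ M) {c : X.B} (hc : c ∈ X.O₀)
    (hnrd : reducedNorm ℚ X.B c = ℓ' * ℓ) :
    ∃ a ∈ X.O₀, ∃ b ∈ X.O₀, a * b = c ∧ reducedNorm ℚ X.B a = ℓ' ∧ reducedNorm ℚ X.B b = ℓ := by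
  classical
  obtain ⟨fd₀, h₀⟩ := X.exists_isHypFundamentalDomain_hull
  have hD0 : D ≠ 0 := fun h => by simpa [h] using X.squarefree
  have hcop : ℓ'.Coprime ℓ := (Nat.coprime_primes hℓ' hℓ).mpr (Ne.symm hne)
  rcases Nat.lt_or_ge 1 D with hD | hD
  · exact (X.toShimuraCurveData fd₀ h₀).exists_mul_eq_of_reducedNorm_eq_mul hD hM hc hℓ'.pos hℓ.pos
      hcop hnrd
  · obtain rfl : D = 1 := le_antisymm hD (Nat.one_le_iff_ne_zero.mpr hD0)
    obtain ⟨-, h, -, H0⟩ := (X.toShimuraCurveData fd₀ h₀).exists_conj_of_discr_one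
    have H : ∀ m : Matrix (Fin 2) (Fin 2) ℝ, (∃ x ∈ X.O₀, X.ι x = m) ↔
        ∃ A : Matrix (Fin 2) (Fin 2) ℤ, (M : ℤ) ∣ A 1 0 ∧
          m = (h : Matrix (Fin 2) (Fin 2) ℝ) * A.map (Int.cast : ℤ → ℝ) *
            ((h⁻¹ : GL (Fin 2) ℝ) : Matrix (Fin 2) (Fin 2) ℝ) := H0
    -- `ι c = h A h⁻¹` with `M ∣ A₁₀`, `det A = ℓ' ℓ`
    obtain ⟨A, hA10, hA⟩ := (H (X.ι c)).mp ⟨c, hc, rfl⟩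
    have hdetA : A.det = (ℓ' : ℤ) * ℓ := by
      have h1 : ((A.det : ℤ) : ℝ) = ((ℓ' : ℤ) * ℓ : ℤ) := by
        rw [← det_map_intCast_real, Int.cast_mul, Int.cast_natCast, Int.cast_natCast]
        have h2 : (X.ι c).det = ((h : Matrix (Fin 2) (Fin 2) ℝ) * A.map (Int.cast : ℤ → ℝ) *
            ((h⁻¹ : GL (Fin 2) ℝ) : Matrix (Fin 2) (Fin 2) ℝ)).det := by rw [hA]
        rw [Matrix.det_mul, Matrix.det_mul, mul_comm ((h : Matrix (Fin 2) (Fin 2) ℝ).det), mul_assoc,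
          ← Matrix.det_mul, ← Units.val_mul, mul_inv_cancel, Units.val_one, Matrix.det_one, mul_one,
          AlgHom.det_eq_reducedNorm X.ι, hnrd] at h2
        rw [← h2]
        push_cast
        rfl
      exact_mod_cast h1
    obtain ⟨A', B, hAB, hdetA', hdetB, hA'10, hB10⟩ :=
      exists_intMatrix_mul_eq_of_det_eq_mul hℓ hℓM hdetA hA10
    -- back to `O₀`
    obtain ⟨a, ha, hιa⟩ := (H ((h : Matrix (Fin 2) (Fin 2) ℝ) * A'.map (Int.cast : ℤ → ℝ) *
      ((h⁻¹ : GL (Fin 2) ℝ) : Matrix (Fin 2) (Fin 2) ℝ))).mpr ⟨A', hA'10, rfl⟩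
    obtain ⟨b, hb, hιb⟩ := (H ((h : Matrix (Fin 2) (Fin 2) ℝ) * B.map (Int.cast : ℤ → ℝ) *
      ((h⁻¹ : GL (Fin 2) ℝ) : Matrix (Fin 2) (Fin 2) ℝ))).mpr ⟨B, hB10, rfl⟩
    have hhinv : ((h⁻¹ : GL (Fin 2) ℝ) : Matrix (Fin 2) (Fin 2) ℝ) * (h : Matrix (Fin 2) (Fin 2) ℝ) = 1 := by
      rw [← Units.val_mul, inv_mul_cancel, Units.val_one]
    refine ⟨a, ha, b, hb, X.ι_injective ?_, ?_, ?_⟩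
    · rw [map_mul, hιa, hιb, hA, ← hAB]
      have e : (A' * B).map (Int.cast : ℤ → ℝ) = A'.map (Int.cast : ℤ → ℝ) * B.map (Int.cast : ℤ → ℝ) :=
        Matrix.map_mul (f := Int.castRingHom ℝ)
      rw [e]
      simp only [mul_assoc]
      rw [← mul_assoc ((h⁻¹ : GL (Fin 2) ℝ) : Matrix (Fin 2) (Fin 2) ℝ) (h : Matrix (Fin 2) (Fin 2) ℝ),
        hhinv, one_mul]
    · refine reducedNorm_eq_natCast_of_det_eq X.ι hιa ?_
      rw [Matrix.det_mul, Matrix.det_mul, mul_comm ((h : Matrix (Fin 2) (Fin 2) ℝ).det), mul_assoc,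
        ← Matrix.det_mul, ← Units.val_mul, mul_inv_cancel, Units.val_one, Matrix.det_one, mul_one,
        det_map_intCast_real, hdetA', Int.cast_natCast]
    · refine reducedNorm_eq_natCast_of_det_eq X.ι hιb ?_
      rw [Matrix.det_mul, Matrix.det_mul, mul_comm ((h : Matrix (Fin 2) (Fin 2) ℝ).det), mul_assoc,
        ← Matrix.det_mul, ← Units.val_mul, mul_inv_cancel, Units.val_one, Matrix.det_one, mul_one,
        det_map_intCast_real, hdetB, Int.cast_natCast]

/-- **Existence of the factorisation in the Cartan order `O`.** For distinct primes `ℓ, ℓ'` with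
`ℓ ∤ M` and `ℓ ∉ C`, every `c ∈ O` with `nrd c = ℓ' ℓ` is `c = a b` with `a, b ∈ O`, `nrd a = ℓ'`,
`nrd b = ℓ`. Factor `c = a₀ b₀` in the hull; move `b₀` into `O` by a norm-one hull unit `u`
(`exists_normOne_mul_mem`: `b = u b₀ ∈ O`), put `a = a₀ ū`; then `a b = c`, and `a ∈ O` since
`(∏_C q) • a ∈ O`, `a b ∈ O`, `nrd b = ℓ` prime to `∏_C q` (`mem_of_smul_mem_of_mul_mem_of_reducedNorm`).
[cite: Eichler1973, Ch. II §6 Thm. 2] [cite: VignerasLNM800, Ch. III §4 Thm. 4.3 and §5 Cor. 5.7] [cite: KohenPacetti2016, §1.3] -/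
theorem exists_mul_eq_of_reducedNorm_eq_mul (hM : 0 < M) {ℓ ℓ' : ℕ} (hℓ : ℓ.Prime) (hℓ' : ℓ'.Prime)
    (hne : ℓ ≠ ℓ') (hℓM : ¬ ℓ ∣ M) (hℓC : ∀ q ∈ C, q ≠ ℓ) {c : X.B} (hc : c ∈ X.O)
    (hnrd : reducedNorm ℚ X.B c = ℓ' * ℓ) :
    ∃ a ∈ X.O, ∃ b ∈ X.O, a * b = c ∧ reducedNorm ℚ X.B a = ℓ' ∧ reducedNorm ℚ X.B b = ℓ := by
  have hO := X.isOrder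
  have hO₀ : Brandt.IsOrder X.B X.O₀ := X.isEichlerOrder.isOrder
  obtain ⟨a₀, ha₀, b₀, hb₀, habc, hna₀, hnb₀⟩ :=
    X.exists_mul_eq_of_reducedNorm_eq_mul_hull hM hℓ hℓ' hne hℓM (X.le hc) hnrd
  obtain ⟨u, hu, hnu, hub₀⟩ := X.exists_normOne_mul_mem hℓ hℓC hb₀ hnb₀
  set ub : X.B := standardInvolution ℚ X.B u with hubdef
  have hubO₀ : ub ∈ X.O₀ := hO₀.standardInvolution_mem hu
  have huub : u * ub = 1 := by
    rw [hubdef, mul_standardInvolution_holds ℚ X.B u, hnu, map_one]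
  have hubu : ub * u = 1 := by
    rw [hubdef, IsQuaternionAlgebra.standardInvolution_mul (K := ℚ), hnu, map_one]
  set a : X.B := a₀ * ub with hadef
  set b : X.B := u * b₀ with hbdef
  have hab : a * b = c := by
    rw [hadef, hbdef, mul_assoc, ← mul_assoc ub, hubu, one_mul, habc]
  have hnb : reducedNorm ℚ X.B b = ℓ := by
    rw [hbdef, reducedNorm_mul_holds ℚ X.B u b₀, hnu, one_mul, hnb₀]
  have hna : reducedNorm ℚ X.B a = ℓ' := by
    have h := reducedNorm_mul_holds ℚ X.B a b
    rw [hab, hnrd, hnb] at h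
    have hℓ0 : (ℓ : ℚ) ≠ 0 := by exact_mod_cast hℓ.ne_zero
    exact (mul_right_cancel₀ hℓ0 h).symm
  have haO₀ : a ∈ X.O₀ := hO₀.mul_mem _ ha₀ _ hubO₀
  have hcopC : ℓ.Coprime (∏ q ∈ C, q) :=
    Nat.Coprime.prod_right fun q hq => (Nat.coprime_primes hℓ (X.coprime q hq).1).mpr (hℓC q hq).symm
  have haO : a ∈ X.O :=
    mem_of_smul_mem_of_mul_mem_of_reducedNorm hO hcopC (X.smul_mem a haO₀) hub₀ hnb
      (by rw [hab]; exact hc)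
  exact ⟨a, haO, b, hub₀, hab, hna, hnb⟩

/-! ### 3. The coset spaces: `(Γα, Γβ) ↦ Γ α β_out` is a bijection
`Γ∖ι(O(ℓ')) × Γ∖ι(O(ℓ)) → Γ∖ι(O(ℓ' ℓ))` -/

/-- Unpacking `ℓ ∤ D M ∏_C q` for a prime `ℓ`: `0 < M`, `ℓ ∤ M` and `ℓ` is not a Cartan prime.
[cite: KohenPacetti2016, §1.3] -/
theorem pos_and_not_dvd_of_not_dvd {ℓ : ℕ} (hℓDMC : ¬ ℓ ∣ D * M * ∏ q ∈ C, q) :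
    0 < M ∧ ¬ ℓ ∣ M ∧ ∀ q ∈ C, q ≠ ℓ := by
  refine ⟨?_, fun h => hℓDMC (Dvd.dvd.mul_right (dvd_mul_of_dvd_right h D) _), fun q hq hqℓ => ?_⟩
  · rcases Nat.eq_zero_or_pos M with rfl | h
    · exact absurd (by simp) hℓDMC
    · exact h
  · subst hqℓ
    exact hℓDMC (dvd_mul_of_dvd_right (Finset.dvd_prod_of_mem _ hq) _)

/-- **Surjectivity of `(Γα, Γβ) ↦ Γ α β_out`** for distinct good primes `ℓ' , ℓ`: every coset in
`Γ∖ι(O(ℓ' ℓ))` is `Γ · α · β` with `α` the chosen representative of a coset of `Γ∖ι(O(ℓ'))` and `β`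
the chosen representative of a coset of `Γ∖ι(O(ℓ))` — factor a representative `ι(c)`, `c = a b`
(`exists_mul_eq_of_reducedNorm_eq_mul`), and move the unit relating `ι(b)` to the chosen
representative of its coset over to `a`. [cite: Eichler1973, Ch. II §6 Thm. 2] [cite: ShimuraIATAF1971, §3.3] -/
theorem exists_mk_out_mul_out_eq {ℓ ℓ' : ℕ} (hℓ : ℓ.Prime) (hℓ' : ℓ'.Prime) (hne : ℓ ≠ ℓ')
    (hℓDMC : ¬ ℓ ∣ D * M * ∏ q ∈ C, q) (Q : Quotient (X.heckeSetoid (ℓ' * ℓ))) :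
    ∃ (A : Quotient (X.heckeSetoid ℓ')) (B : Quotient (X.heckeSetoid ℓ)),
      Quotient.mk (X.heckeSetoid (ℓ' * ℓ))
        ⟨((A.out : X.heckeSet ℓ') : GL (Fin 2) ℝ) * ((B.out : X.heckeSet ℓ) : GL (Fin 2) ℝ),
          X.mul_mem_heckeSet_mul A.out.2 B.out.2⟩ = Q := by
  obtain ⟨hM, hℓM, hℓC⟩ := pos_and_not_dvd_of_not_dvd hℓDMC
  obtain ⟨c, hc, hcC, hnc⟩ := X.exists_mem_O_ι_eq_of_mem_heckeSet (Q.out : X.heckeSet (ℓ' * ℓ)).2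
  obtain ⟨a, ha, b, hb, habc, hna, hnb⟩ :=
    X.exists_mul_eq_of_reducedNorm_eq_mul hM hℓ hℓ' hne hℓM hℓC hc (by rw [hnc, Nat.cast_mul])
  obtain ⟨β₀, hβ₀⟩ := X.exists_heckeSet_coe_eq_ι hb hℓ.pos hnb
  obtain ⟨α₀, hα₀⟩ := X.exists_heckeSet_coe_eq_ι ha hℓ'.pos hna
  set B : Quotient (X.heckeSetoid ℓ) := Quotient.mk _ β₀ with hB
  obtain ⟨δ, hδ, hδeq⟩ : (X.heckeSetoid ℓ) β₀ B.out := Quotient.exact (by rw [Quotient.out_eq])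
  have hα₁ : (α₀ : GL (Fin 2) ℝ) * δ⁻¹ ∈ X.heckeSet ℓ' := X.mul_mem_heckeSet α₀.2 (inv_mem hδ)
  set A : Quotient (X.heckeSetoid ℓ') := Quotient.mk _ ⟨_, hα₁⟩ with hA
  obtain ⟨ε, hε, hεeq⟩ : (X.heckeSetoid ℓ') ⟨_, hα₁⟩ A.out := Quotient.exact (by rw [Quotient.out_eq])
  refine ⟨A, B, ?_⟩
  conv_rhs => rw [← Quotient.out_eq Q]
  refine Quotient.sound ⟨ε⁻¹, inv_mem hε, ?_⟩
  change ε⁻¹ * (((A.out : X.heckeSet ℓ') : GL (Fin 2) ℝ) * ((B.out : X.heckeSet ℓ) : GL (Fin 2) ℝ)) =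
    ((Q.out : X.heckeSet (ℓ' * ℓ)) : GL (Fin 2) ℝ)
  have hA' : ((A.out : X.heckeSet ℓ') : GL (Fin 2) ℝ) = ε * ((α₀ : GL (Fin 2) ℝ) * δ⁻¹) := hεeq.symm
  have hB' : ((B.out : X.heckeSet ℓ) : GL (Fin 2) ℝ) = δ * (β₀ : GL (Fin 2) ℝ) := hδeq.symm
  rw [hA', hB']
  refine Units.ext ?_
  have : ε⁻¹ * (ε * ((α₀ : GL (Fin 2) ℝ) * δ⁻¹) * (δ * (β₀ : GL (Fin 2) ℝ))) =
      (α₀ : GL (Fin 2) ℝ) * (β₀ : GL (Fin 2) ℝ) := by group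
  rw [this, Units.val_mul, hα₀, hβ₀, ← map_mul, habc, hcC]

/-- **Injectivity of `(Γα, Γβ) ↦ Γ α β_out`** (`gcd(n₁, n₂) = 1`, `n₂ ≥ 1`; any Cartan datum): if
`Γ α β = Γ α' β'` for chosen representatives then the cosets agree — pull back to `O`, apply the
uniqueness of the factorisation (`exists_normOne_of_mul_eq_mul`) to get `Γ β = Γ β'`, hence `β = β'`,
and cancel. [cite: Eichler1973, Ch. II §6 Thm. 2] [cite: ShimuraIATAF1971, §3.3] -/
private theorem eq_of_mk_out_mul_out_eq {n₁ n₂ : ℕ} (hcop : n₁.Coprime n₂) (hn₂ : 0 < n₂)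
    {A A' : Quotient (X.heckeSetoid n₁)} {B B' : Quotient (X.heckeSetoid n₂)}
    (h : Quotient.mk (X.heckeSetoid (n₁ * n₂))
        ⟨((A.out : X.heckeSet n₁) : GL (Fin 2) ℝ) * ((B.out : X.heckeSet n₂) : GL (Fin 2) ℝ),
          X.mul_mem_heckeSet_mul A.out.2 B.out.2⟩ =
      Quotient.mk (X.heckeSetoid (n₁ * n₂))
        ⟨((A'.out : X.heckeSet n₁) : GL (Fin 2) ℝ) * ((B'.out : X.heckeSet n₂) : GL (Fin 2) ℝ),
          X.mul_mem_heckeSet_mul A'.out.2 B'.out.2⟩) :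
    A = A' ∧ B = B' := by
  have hO := X.isOrder
  obtain ⟨ε, hε, hεeq⟩ := Quotient.exact h
  change ε * (((A.out : X.heckeSet n₁) : GL (Fin 2) ℝ) * ((B.out : X.heckeSet n₂) : GL (Fin 2) ℝ)) =
    ((A'.out : X.heckeSet n₁) : GL (Fin 2) ℝ) * ((B'.out : X.heckeSet n₂) : GL (Fin 2) ℝ) at hεeq
  rw [← mul_assoc] at hεeq
  obtain ⟨a, ha, haA, -⟩ := X.exists_mem_O_ι_eq_of_mem_heckeSet (A.out : X.heckeSet n₁).2
  obtain ⟨a', ha', haA', hna'⟩ := X.exists_mem_O_ι_eq_of_mem_heckeSet (A'.out : X.heckeSet n₁).2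
  obtain ⟨b, hb, hbB, hnb⟩ := X.exists_mem_O_ι_eq_of_mem_heckeSet (B.out : X.heckeSet n₂).2
  obtain ⟨b', hb', hbB', hnb'⟩ := X.exists_mem_O_ι_eq_of_mem_heckeSet (B'.out : X.heckeSet n₂).2
  obtain ⟨w, hw, hwε, -⟩ := X.exists_mem_O_ι_eq_of_mem_Gamma hε
  have heqO : (w * a) * b = a' * b' := X.ι_injective (by
    rw [map_mul, map_mul, map_mul, hwε, haA, hbB, haA', hbB', ← Units.val_mul, ← Units.val_mul,
      ← Units.val_mul, hεeq])
  obtain ⟨u, hu, hnu, hub, -⟩ := X.exists_normOne_of_mul_eq_mul (hO.mul_mem _ hw _ ha) ha' hb hb'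
    hcop hn₂.ne' hna' hnb hnb' heqO
  obtain ⟨γ, hγ, hγu⟩ := X.exists_mem_Gamma_coe_eq_ι hu hnu
  have hBB' : B = B' := by
    rw [← Quotient.out_eq B, ← Quotient.out_eq B']
    refine Quotient.sound ⟨γ, hγ, Units.ext ?_⟩
    rw [Units.val_mul, hγu, ← hbB, ← map_mul, hub, hbB']
  subst hBB'
  refine ⟨?_, rfl⟩
  rw [← Quotient.out_eq A, ← Quotient.out_eq A']
  exact Quotient.sound ⟨ε, hε, mul_right_cancel hεeq⟩

/-- **`Γ∖ι(O(ℓ))` is finite** for a good prime `ℓ` (the tree's theorem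
`cartanLevel_card_heckeCosets_eq_holds`: it has `ℓ + 1` elements). [cite: ShimuraIATAF1971, Prop. 3.36 and §3.3] -/
theorem finite_quotient_heckeSetoid_of_prime {ℓ : ℕ} (hℓ : ℓ.Prime)
    (hℓDMC : ¬ ℓ ∣ D * M * ∏ q ∈ C, q) : Finite (Quotient (X.heckeSetoid ℓ)) :=
  (cartanLevel_card_heckeCosets_eq_holds D M C X ℓ hℓ hℓDMC).1

/-- **`Γ∖ι(O(ℓ' ℓ))` is finite** for distinct good primes `ℓ, ℓ'`: it is the image of the finite set
`Γ∖ι(O(ℓ')) × Γ∖ι(O(ℓ))` under `(Γα, Γβ) ↦ Γ α β` (`exists_mk_out_mul_out_eq`).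
[cite: Eichler1973, Ch. II §6 Thm. 2] [cite: ShimuraIATAF1971, §3.3] -/
theorem finite_quotient_heckeSetoid_mul {ℓ ℓ' : ℕ} (hℓ : ℓ.Prime) (hℓ' : ℓ'.Prime) (hne : ℓ ≠ ℓ')
    (hℓDMC : ¬ ℓ ∣ D * M * ∏ q ∈ C, q) (hℓ'DMC : ¬ ℓ' ∣ D * M * ∏ q ∈ C, q) :
    Finite (Quotient (X.heckeSetoid (ℓ' * ℓ))) := by
  haveI := X.finite_quotient_heckeSetoid_of_prime hℓ hℓDMC
  haveI := X.finite_quotient_heckeSetoid_of_prime hℓ' hℓ'DMC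
  refine Finite.of_surjective (fun p : Quotient (X.heckeSetoid ℓ') × Quotient (X.heckeSetoid ℓ) =>
    Quotient.mk (X.heckeSetoid (ℓ' * ℓ))
      ⟨((p.1.out : X.heckeSet ℓ') : GL (Fin 2) ℝ) * ((p.2.out : X.heckeSet ℓ) : GL (Fin 2) ℝ),
        X.mul_mem_heckeSet_mul p.1.out.2 p.2.out.2⟩) fun Q => ?_
  obtain ⟨A, B, hAB⟩ := X.exists_mk_out_mul_out_eq hℓ hℓ' hne hℓDMC Q
  exact ⟨(A, B), hAB⟩

/-! ### 4. `T_ℓ ∘ T_ℓ' = T_{ℓ' ℓ}` and `T_ℓ T_ℓ' = T_ℓ' T_ℓ` for distinct good primes -/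

/-- With a `Fintype` structure on `Γ∖ι(O(n))`, `T_n h = ∑_q h ∣[2] q.out` as functions on `ℍ`.
[cite: KohenPacetti2016, §1.3] -/
private theorem heckeFun_eq_sum (n : ℕ) [Fintype (Quotient (X.heckeSetoid n))] (h : ℍ → ℂ) :
    X.heckeFun n h =
      ∑ q : Quotient (X.heckeSetoid n), (h ∣[(2 : ℤ)] ((q.out : X.heckeSet n) : GL (Fin 2) ℝ)) := by
  funext τ
  simp only [CartanLevelCurveData.heckeFun, finsum_eq_sum_of_fintype, Finset.sum_apply]

/-- **Multiplicativity for two distinct good primes**: `T_ℓ (T_ℓ' h) = T_{ℓ' ℓ} h` for every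
`Γ`-invariant `h` of weight `2` and distinct primes `ℓ, ℓ'` not dividing `D M ∏_C q`. Proof:
`T_ℓ T_ℓ' h = Σ_β Σ_α h ∣ (α β)` over chosen representatives, and `(Γα, Γβ) ↦ Γ α β` is a bijection
onto `Γ∖ι(O(ℓ' ℓ))` (`exists_mk_out_mul_out_eq`, `eq_of_mk_out_mul_out_eq`); `h ∣ (α β) = h ∣ (Γ α β)_out`
by `Γ`-invariance (Eichler, LNM 320, II §6 Thm. 2 (18): `T(ℓ') T(ℓ) = T(ℓ' ℓ)` for the indefinite
order; Shimura Thm. 3.24 (4) in the modular case). [cite: Eichler1973, Ch. II §6 Thm. 2 (18)] [cite: ShimuraIATAF1971, §3.3 and Prop. 3.8] -/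
theorem heckeFun_heckeFun_of_primes {ℓ ℓ' : ℕ} (hℓ : ℓ.Prime) (hℓ' : ℓ'.Prime) (hne : ℓ ≠ ℓ')
    (hℓDMC : ¬ ℓ ∣ D * M * ∏ q ∈ C, q) (hℓ'DMC : ¬ ℓ' ∣ D * M * ∏ q ∈ C, q)
    (h : ℍ → ℂ) (hh : ∀ δ ∈ X.Gamma, h ∣[(2 : ℤ)] δ = h) :
    X.heckeFun ℓ (X.heckeFun ℓ' h) = X.heckeFun (ℓ' * ℓ) h := by
  classical
  haveI := X.finite_quotient_heckeSetoid_of_prime hℓ hℓDMC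
  haveI := X.finite_quotient_heckeSetoid_of_prime hℓ' hℓ'DMC
  haveI := X.finite_quotient_heckeSetoid_mul hℓ hℓ' hne hℓDMC hℓ'DMC
  letI : Fintype (Quotient (X.heckeSetoid ℓ')) := Fintype.ofFinite _
  letI : Fintype (Quotient (X.heckeSetoid ℓ)) := Fintype.ofFinite _
  letI : Fintype (Quotient (X.heckeSetoid (ℓ' * ℓ))) := Fintype.ofFinite _
  have hcop : ℓ'.Coprime ℓ := (Nat.coprime_primes hℓ' hℓ).mpr (Ne.symm hne)
  -- the bijection `(Γα, Γβ) ↦ Γ α β_out`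
  let Ψ : Quotient (X.heckeSetoid ℓ') × Quotient (X.heckeSetoid ℓ) →
      Quotient (X.heckeSetoid (ℓ' * ℓ)) := fun p =>
    Quotient.mk (X.heckeSetoid (ℓ' * ℓ))
      ⟨((p.1.out : X.heckeSet ℓ') : GL (Fin 2) ℝ) * ((p.2.out : X.heckeSet ℓ) : GL (Fin 2) ℝ),
        X.mul_mem_heckeSet_mul p.1.out.2 p.2.out.2⟩
  have hΨ : Function.Bijective Ψ := by
    refine ⟨fun p q hpq => ?_, fun Q => ?_⟩
    · obtain ⟨h1, h2⟩ := X.eq_of_mk_out_mul_out_eq hcop hℓ.pos hpq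
      exact Prod.ext h1 h2
    · obtain ⟨A, B, hAB⟩ := X.exists_mk_out_mul_out_eq hℓ hℓ' hne hℓDMC Q
      exact ⟨(A, B), hAB⟩
  let e := Equiv.ofBijective Ψ hΨ
  -- termwise: `h ∣ α ∣ β = h ∣ (Γ α β)_out`
  have hterm : ∀ p : Quotient (X.heckeSetoid ℓ') × Quotient (X.heckeSetoid ℓ),
      (h ∣[(2 : ℤ)] ((p.1.out : X.heckeSet ℓ') : GL (Fin 2) ℝ)) ∣[(2 : ℤ)]
          ((p.2.out : X.heckeSet ℓ) : GL (Fin 2) ℝ) =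
        h ∣[(2 : ℤ)] (((e p).out : X.heckeSet (ℓ' * ℓ)) : GL (Fin 2) ℝ) := by
    intro p
    obtain ⟨δ, hδ, hδeq⟩ : (X.heckeSetoid (ℓ' * ℓ))
        ⟨((p.1.out : X.heckeSet ℓ') : GL (Fin 2) ℝ) * ((p.2.out : X.heckeSet ℓ) : GL (Fin 2) ℝ),
          X.mul_mem_heckeSet_mul p.1.out.2 p.2.out.2⟩ (e p).out :=
      Quotient.exact (by rw [Quotient.out_eq]; rfl)
    change δ * (((p.1.out : X.heckeSet ℓ') : GL (Fin 2) ℝ) * ((p.2.out : X.heckeSet ℓ) : GL (Fin 2) ℝ)) =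
      (((e p).out : X.heckeSet (ℓ' * ℓ)) : GL (Fin 2) ℝ) at hδeq
    rw [← hδeq, SlashAction.slash_mul, SlashAction.slash_mul, hh δ hδ]
  rw [X.heckeFun_eq_sum ℓ, X.heckeFun_eq_sum ℓ', X.heckeFun_eq_sum (ℓ' * ℓ)]
  simp_rw [SlashAction.sum_slash]
  rw [← Fintype.sum_prod_type_right' fun (A : Quotient (X.heckeSetoid ℓ'))
    (B : Quotient (X.heckeSetoid ℓ)) =>
      (h ∣[(2 : ℤ)] ((A.out : X.heckeSet ℓ') : GL (Fin 2) ℝ)) ∣[(2 : ℤ)] ((B.out : X.heckeSet ℓ) : GL (Fin 2) ℝ)]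
  simp_rw [hterm]
  exact e.sum_comp (fun Q => h ∣[(2 : ℤ)] ((Q.out : X.heckeSet (ℓ' * ℓ)) : GL (Fin 2) ℝ))

/-- **The Hecke operators `T_ℓ`, `T_ℓ'` of a Cartan-level Shimura curve commute** for distinct primes
`ℓ, ℓ'` not dividing `D M ∏_C q`: `T_ℓ (T_ℓ' h) = T_ℓ' (T_ℓ h)` for `Γ`-invariant `h` of weight `2` —
both sides are `T_{ℓ ℓ'} h` (Shimura Prop. 3.8 / §3.3: the Hecke ring of a quaternion unit group away
from the level is commutative; Eichler's `T(ℓ)T(ℓ') = T(ℓℓ')`; Kohen–Pacetti §1.3 for `X_ns`).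
[cite: ShimuraIATAF1971, Prop. 3.8 and §3.3] [cite: Eichler1973, Ch. II §6 Thm. 2 (18)] [cite: KohenPacetti2016, §1.3] -/
theorem heckeFun_comm_of_primes {ℓ ℓ' : ℕ} (hℓ : ℓ.Prime) (hℓ' : ℓ'.Prime)
    (hℓDMC : ¬ ℓ ∣ D * M * ∏ q ∈ C, q) (hℓ'DMC : ¬ ℓ' ∣ D * M * ∏ q ∈ C, q)
    (h : ℍ → ℂ) (hh : ∀ δ ∈ X.Gamma, h ∣[(2 : ℤ)] δ = h) :
    X.heckeFun ℓ (X.heckeFun ℓ' h) = X.heckeFun ℓ' (X.heckeFun ℓ h) := by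
  rcases eq_or_ne ℓ ℓ' with rfl | hne
  · rfl
  · rw [X.heckeFun_heckeFun_of_primes hℓ hℓ' hne hℓDMC hℓ'DMC h hh,
      X.heckeFun_heckeFun_of_primes hℓ' hℓ hne.symm hℓ'DMC hℓDMC h hh, mul_comm]

end CartanLevelCurveData

end Literature.NumberTheory.Automorphic

end
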